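import Summits.QuantumFields.YangMills.Theorems.BalabanUVNodesN15KingModelComplexLinkHolomorphy
import Summits.QuantumFields.YangMills.Theorems.BalabanUVNodesN15KingModelComplexLinkBounds
import Mathlib.Analysis.Normed.Algebra.MatrixExponential
import Mathlib.Analysis.SpecialFunctions.Exponential
import HarnessLib
/-!
# BalabanUVNodes ∕ N15 — THE KING-MODEL RUNG (PART Ϛ-j): PRINT's PARAMETRISATION `U′U`, `U′ = e^{A}` — the exponential chart `A ↦ (e^{A(b)}U₀(b), U₀(b)⁻¹e^{−A(b)})` is analytic, lands in
# the complex window for `‖A(b)‖ ≤ α`, `2(d+1)c(e^α − 1) < m²`, and `A ↦ G(e^{A}U₀)` IS AN ANALYTIC FUNCTION OF `A` at every unitary `U₀`; `u(n)`-valued `A` stays on the unitary slice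
# (Track A, DAG node N15 = NE2; FAN-OUT v1.1 §N15 s3 «KING-MODEL RUNG … + what the curved case adds»; count-neutral)
HONEST FRAMING.  Count-neutral (cell `pub-ymgap`, seat `pub-ymgap-dag-n15-e` g43; `--supports stmt-QuantumFields-27247 --as helper` = K3ᴬ, KEY MAP v3).  One finite torus at fixed
spacing; King's `A = 0` model, FINE covariance layer only; nothing of Bałaban's (3.42) ∕ Thm 3.4 for `G(U)` asserted; nothing continuum ∕ ℝ⁴ ∕ OS ∕ Clay; NOT a node discharge.
WHAT IS DECIDED.  [Balaban1985BackgroundPropagators] p.400 l.1–4 «Such a neighbourhood is given by configurations U′U satisfying the condition (3.37), i.e. U′ = e^{iηA}, where A is a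
sufficiently regular configuration with values in the complexified Lie algebra gᶜ … We will assume that α₁ is sufficiently small.»; Thm 3.4 p.400 «extend to configurations U′U for
α₁ ≤ a₁ as analytic functions of A».  In King's model (the two-sided family of PART Ϛ-a, `𝕜 = ℝ` or `ℂ`; here `A(b)` stands for print's `iηA(b)`, an arbitrary `n × n` matrix):
* §0 `l2_opNorm_pow_le`, ★ `l2_opNorm_exp_le` (`‖e^{A}‖_{op} ≤ e^{‖A‖}`, the exponential series in the fibre operator norm);
* §1 defs **`expLink K A U₀`** (`b ↦ e^{A(b)}U₀(b)` = print's `U′U`), **`expLinkInv K A U₀`** (`b ↦ U₀(b)⁻¹e^{−A(b)}`); `expLink_zero`, `expLinkInv_zero`, ★ `expLinkInv_eq_inv` (`= (U′U)(b)⁻¹`: the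
  chart IS print's `Gᶜ` slice `V = U⁻¹`, `Matrix.exp_neg`), `cxLapF_expChart_zero` (at `A = 0`, unitary `U₀`: PART Ͱ's `−cΔ_{U₀}+m²`);
* §2 ★ `analyticAt_expLink`, `analyticAt_expLinkInv`, ★ `analyticAt_expChart` (Mathlib `NormedSpace.exp_analytic` in the complete normed algebra `Matrix n n 𝕜`, bondwise, `AnalyticAt.pi`);
* §3 ★★★ **`analyticAt_cxLapF_inv_expChart`** — `A ↦ G(e^{A}U₀) := (M_{e^{A}U₀, U₀⁻¹e^{−A}})⁻¹` IS ANALYTIC AT EVERY `A` WHERE THE OPERATOR IS INVERTIBLE (PART Ϛ-e ∘ the chart);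
  ★★★ **`analyticAt_cxLapF_inv_expChart_zero`** — in particular AT `A = 0` FOR EVERY UNITARY `U₀` (`c ≥ 0`, `m² > 0`), with value `(−cΔ_{U₀}+m²)⁻¹` there (`cxLapF_expChart_inv_zero`):
  Thm 3.4's «analytic functions of A» in the model;
* §4 THE QUANTITATIVE NEIGHBOURHOOD: for unitary `U₀` and `‖A(b)‖ ≤ α` on every bond, `‖e^{A(b)}U₀(b)‖, ‖U₀(b)⁻¹e^{−A(b)}‖ ≤ e^α = 1 + (e^α − 1)` (`norm_expLink_le`, `norm_expLinkInv_le`), so for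
  `2(d+1)c(e^α − 1) < m²`: ★★ **`isUnit_cxLapF_expChart`**, ★★ **`l2_opNorm_blk_cxLapF_inv_expChart_le`** (domination by King's kernel at `(e^α c, m² − 2(d+1)c(e^α−1))`), ★★
  **`expChart_window_iff`** (`c > 0`: the condition is `α < log(1 + m²∕(2(d+1)c))` — print's unspecified `a₁` has the model value `log(1 + m²∕(2(d+1)c))` for this chart, sufficient);
* §5 THE REAL SLICE: if every `A(b)` is skew-adjoint (`A(b)ᴴ = −A(b)`, print's `iηA` with `A ∈ g = u(n)`) then `e^{A(b)}U₀(b)` is unitary (`expLink_mem_unitaryGroup_of_skew`),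
  `U₀(b)⁻¹e^{−A(b)} = (e^{A(b)}U₀(b))ᴴ` (`expLinkInv_eq_conjTranspose_of_skew`) and ★ `cxLapF_expChart_of_skew`: the chart value is PART Ͱ's Hermitian `−cΔ_{e^{A}U₀}+m²`.
PRIOR TREE ART (by name): Ϛ-a (`cxLapF`, `cxLapF_adjoint`, `cxLapF_inv_of_unitary`), Ϛ-b (`isUnit_cxLapF`, `l2_opNorm_blk_cxLapF_inv_le`, `unitary_mem_window`), Ϛ-e (`CxLinks`, `analyticAt_cxLapF_inv`),
Ͱ-a (`covLapF`), Ͱ-l (`l2_opNorm_of_mem_unitaryGroup_le`), Mathlib (`NormedSpace.exp`, `NormedSpace.exp_analytic`, `NormedSpace.exp_series_hasSum_exp'`, `NormedSpace.exp_zero`,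
`Matrix.exp_neg`, `Matrix.exp_conjTranspose`, `Matrix.exp_add_of_commute`, `Matrix.mul_inv_rev`, `Real.exp_eq_exp_ℝ`, `Real.add_one_le_exp`, `AnalyticAt.pi`∕`.prod`∕`.mul`, `ContinuousLinearMap.proj`,
`CStarRing.norm_mem_unitary_mul`).  Dedup (rg at filing): basename 0 files; needles `expLink|expChart|l2_opNorm_exp_le` 0 tree files.  Locators: [Balaban1985BackgroundPropagators] p.400 l.1–4,
Thm 3.4 p.400, (3.37) p.396, (3.50)–(3.53) p.400; [King1986] (4.4) p.670.  0 `sorry`.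
-/

noncomputable section
open scoped BigOperators ComplexConjugate ComplexOrder Topology Matrix.Norms.L2Operator
open Finset Matrix Filter

namespace Summit.QuantumFields.YangMills.BalabanUVNodes.N15KingModelRung.Covariant

open Literature.MathematicalPhysics.QuantumFieldTheory.LatticeDiamagneticInequality (Hopping blk)
open Literature.MathematicalPhysics.QuantumFieldTheory.Balaban1983to89.B5Prop11Plancherel (Tor unitVec)
open Literature.MathematicalPhysics.QuantumFieldTheory.King1986.Torus (lapF)

variable {d : ℕ} (K : Fin (d + 1) → ℕ) [hK : ∀ μ, NeZero (K μ)]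
variable {𝕜 : Type*} [RCLike 𝕜] {n : Type*}

/-! ## §1 (defs first) The exponential chart -/

/-- PRINT's `U′U` WITH `U′ = e^{A}`: the forward transporters `b ↦ e^{A(b)}·U₀(b)` (`A(b)` an arbitrary `n × n` matrix, standing for print's `iηA(b) ∈ gᶜ`).
[cite: Balaban1985BackgroundPropagators, p.400 l.1–4, Thm 3.4 p.400] -/
def expLink [Fintype n] [DecidableEq n] (A U₀ : Tor K × Fin (d + 1) → Matrix n n 𝕜) : Tor K × Fin (d + 1) → Matrix n n 𝕜 :=
  fun b => NormedSpace.exp (A b) * U₀ b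

/-- THE BACKWARD TRANSPORTERS OF THE CHART: `b ↦ U₀(b)⁻¹·e^{−A(b)}` (`= (e^{A(b)}U₀(b))⁻¹` for invertible `U₀(b)`: the `Gᶜ` slice `V = U⁻¹`).
[cite: Balaban1985BackgroundPropagators, p.400 l.1–4, (3.50) p.400] -/
def expLinkInv [Fintype n] [DecidableEq n] (A U₀ : Tor K × Fin (d + 1) → Matrix n n 𝕜) : Tor K × Fin (d + 1) → Matrix n n 𝕜 :=
  fun b => (U₀ b)⁻¹ * NormedSpace.exp (-(A b))

variable [Fintype n] [DecidableEq n]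

/-! ## §0 The exponential in the fibre operator norm -/

omit hK in
/-- `‖A^k‖_{op} ≤ ‖A‖_{op}^k` (all `k`; `‖1‖_{op} ≤ 1`). [folklore] -/
theorem l2_opNorm_pow_le (A : Matrix n n 𝕜) : ∀ k : ℕ, ‖A ^ k‖ ≤ ‖A‖ ^ k
  | 0 => by rw [pow_zero, pow_zero]; exact l2_opNorm_of_mem_unitaryGroup_le (Submonoid.one_mem _)
  | k + 1 => by
      rw [pow_succ, pow_succ]
      exact (norm_mul_le _ _).trans (mul_le_mul_of_nonneg_right (l2_opNorm_pow_le A k) (norm_nonneg _))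

omit hK in
/-- ★ `‖e^{A}‖_{op} ≤ e^{‖A‖_{op}}` (the exponential series term by term). [folklore] -/
theorem l2_opNorm_exp_le (A : Matrix n n 𝕜) : ‖NormedSpace.exp A‖ ≤ Real.exp ‖A‖ := by
  haveI : CompleteSpace (Matrix n n 𝕜) := FiniteDimensional.complete 𝕜 _
  have hA := NormedSpace.exp_series_hasSum_exp' (𝕂 := 𝕜) A
  have hR : HasSum (fun k : ℕ => ((k.factorial : ℝ)⁻¹) • ‖A‖ ^ k) (Real.exp ‖A‖) := by
    rw [Real.exp_eq_exp_ℝ]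
    exact NormedSpace.exp_series_hasSum_exp' (𝕂 := ℝ) ‖A‖
  have hterm : ∀ k : ℕ, ‖((k.factorial : 𝕜)⁻¹) • A ^ k‖ ≤ ((k.factorial : ℝ)⁻¹) • ‖A‖ ^ k := fun k => by
    rw [norm_smul, norm_inv, RCLike.norm_natCast, smul_eq_mul]
    exact mul_le_mul_of_nonneg_left (l2_opNorm_pow_le A k) (inv_nonneg.mpr (Nat.cast_nonneg _))
  have hnorm : Summable (fun k : ℕ => ‖((k.factorial : 𝕜)⁻¹) • A ^ k‖) :=
    Summable.of_nonneg_of_le (fun k => norm_nonneg _) hterm hR.summable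
  rw [← hA.tsum_eq]
  exact (norm_tsum_le_tsum_norm hnorm).trans (hasSum_le hterm hnorm.hasSum hR)

/-! ## §1 (continued) The chart at `A = 0`, and as print's `Gᶜ` slice -/

omit hK in
/-- At `A = 0` the forward field is `U₀`. [folklore] -/
theorem expLink_zero (U₀ : Tor K × Fin (d + 1) → Matrix n n 𝕜) : expLink K (0 : Tor K × Fin (d + 1) → Matrix n n 𝕜) U₀ = U₀ := by
  funext b; simp [expLink, NormedSpace.exp_zero]

omit hK in
/-- At `A = 0` the backward field is `U₀⁻¹`. [folklore] -/
theorem expLinkInv_zero (U₀ : Tor K × Fin (d + 1) → Matrix n n 𝕜) : expLinkInv K (0 : Tor K × Fin (d + 1) → Matrix n n 𝕜) U₀ = fun b => (U₀ b)⁻¹ := by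
  funext b; simp [expLinkInv, NormedSpace.exp_zero]

omit hK in
/-- ★ THE CHART IS PRINT's `Gᶜ` SLICE: for pointwise-invertible `U₀`, `U₀(b)⁻¹e^{−A(b)} = (e^{A(b)}U₀(b))⁻¹`. [cite: Balaban1985BackgroundPropagators, p.400 l.1–4, (3.50) p.400] -/
theorem expLinkInv_eq_inv (A U₀ : Tor K × Fin (d + 1) → Matrix n n 𝕜) (b : Tor K × Fin (d + 1)) :
    expLinkInv K A U₀ b = (expLink K A U₀ b)⁻¹ := by
  unfold expLinkInv expLink
  rw [Matrix.mul_inv_rev, Matrix.exp_neg]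

omit hK in
/-- At `A = 0` and unitary `U₀` the backward field is `U₀^*`. [folklore] -/
theorem expLinkInv_zero_of_unitary {U₀ : Tor K × Fin (d + 1) → Matrix n n 𝕜} (hU₀ : ∀ b, U₀ b ∈ Matrix.unitaryGroup n 𝕜) :
    expLinkInv K (0 : Tor K × Fin (d + 1) → Matrix n n 𝕜) U₀ = fun b => (U₀ b)ᴴ := by
  rw [expLinkInv_zero]
  funext b
  have h1 : (U₀ b)ᴴ * U₀ b = 1 := by simpa only [star_eq_conjTranspose] using Matrix.mem_unitaryGroup_iff'.mp (hU₀ b)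
  exact Matrix.inv_eq_left_inv h1

/-- AT `A = 0` AND UNITARY `U₀` THE CHART VALUE IS PART Ͱ's `−cΔ_{U₀}+m²`. [cite: Balaban1985BackgroundPropagators, Thm 3.4 p.400, (3.23) p.394] -/
theorem cxLapF_expChart_zero (c m2 : ℝ) {U₀ : Tor K × Fin (d + 1) → Matrix n n 𝕜} (hU₀ : ∀ b, U₀ b ∈ Matrix.unitaryGroup n 𝕜) :
    cxLapF K c m2 (expLink K (0 : Tor K × Fin (d + 1) → Matrix n n 𝕜) U₀) (expLinkInv K 0 U₀) = covLapF K c m2 U₀ := by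
  rw [expLink_zero, expLinkInv_zero_of_unitary K hU₀, cxLapF_adjoint]

/-! ## §2 Analyticity of the chart -/

/-- ★ THE FORWARD CHART IS ANALYTIC in `A` (bondwise `A(b) ↦ e^{A(b)}U₀(b)`; Mathlib `NormedSpace.exp_analytic`). [cite: Balaban1985BackgroundPropagators, Thm 3.4 p.400] -/
theorem analyticAt_expLink (U₀ A₀ : Tor K × Fin (d + 1) → Matrix n n 𝕜) :
    AnalyticAt 𝕜 (fun A : Tor K × Fin (d + 1) → Matrix n n 𝕜 => expLink K A U₀) A₀ := by
  haveI : CompleteSpace (Matrix n n 𝕜) := FiniteDimensional.complete 𝕜 _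
  refine AnalyticAt.pi fun b => ?_
  have h1 : AnalyticAt 𝕜 (fun A : Tor K × Fin (d + 1) → Matrix n n 𝕜 => NormedSpace.exp (A b)) A₀ :=
    (NormedSpace.exp_analytic (𝕂 := 𝕜) (A₀ b)).comp_of_eq
      ((ContinuousLinearMap.proj (R := 𝕜) (φ := fun _ : Tor K × Fin (d + 1) => Matrix n n 𝕜) b).analyticAt A₀) rfl
  exact h1.mul analyticAt_const

/-- THE BACKWARD CHART IS ANALYTIC in `A`. [cite: Balaban1985BackgroundPropagators, Thm 3.4 p.400] -/
theorem analyticAt_expLinkInv (U₀ A₀ : Tor K × Fin (d + 1) → Matrix n n 𝕜) :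
    AnalyticAt 𝕜 (fun A : Tor K × Fin (d + 1) → Matrix n n 𝕜 => expLinkInv K A U₀) A₀ := by
  haveI : CompleteSpace (Matrix n n 𝕜) := FiniteDimensional.complete 𝕜 _
  refine AnalyticAt.pi fun b => ?_
  have h1 : AnalyticAt 𝕜 (fun A : Tor K × Fin (d + 1) → Matrix n n 𝕜 => NormedSpace.exp (-(A b))) A₀ :=
    (NormedSpace.exp_analytic (𝕂 := 𝕜) (-(A₀ b))).comp_of_eq
      ((ContinuousLinearMap.proj (R := 𝕜) (φ := fun _ : Tor K × Fin (d + 1) => Matrix n n 𝕜) b).analyticAt A₀).neg rfl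
  exact analyticAt_const.mul h1

/-- ★ THE TWO-SIDED CHART `A ↦ (e^{A}U₀, U₀⁻¹e^{−A})` IS ANALYTIC (values in `CxLinks K 𝕜 n`). [cite: Balaban1985BackgroundPropagators, Thm 3.4 p.400] -/
theorem analyticAt_expChart (U₀ A₀ : Tor K × Fin (d + 1) → Matrix n n 𝕜) :
    AnalyticAt 𝕜 (fun A : Tor K × Fin (d + 1) → Matrix n n 𝕜 => ((expLink K A U₀, expLinkInv K A U₀) : CxLinks K 𝕜 n)) A₀ :=
  (analyticAt_expLink K U₀ A₀).prod (analyticAt_expLinkInv K U₀ A₀)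

/-! ## §3 `A ↦ G(e^{A}U₀)` is analytic -/

/-- ★★★ **`A ↦ G(e^{A}U₀) = (M_{e^{A}U₀, U₀⁻¹e^{−A}})⁻¹` IS ANALYTIC AT EVERY `A` WHERE THE OPERATOR IS INVERTIBLE** (PART Ϛ-e composed with the analytic chart).
[cite: Balaban1985BackgroundPropagators, Thm 3.4 p.400, §3.B p.399 l.37–40] -/
theorem analyticAt_cxLapF_inv_expChart {c m2 : ℝ} {U₀ A₀ : Tor K × Fin (d + 1) → Matrix n n 𝕜}
    (hU : IsUnit (cxLapF K c m2 (expLink K A₀ U₀) (expLinkInv K A₀ U₀))) :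
    AnalyticAt 𝕜 (fun A : Tor K × Fin (d + 1) → Matrix n n 𝕜 => (cxLapF K c m2 (expLink K A U₀) (expLinkInv K A U₀))⁻¹) A₀ := by
  have hcomp : (fun A : Tor K × Fin (d + 1) → Matrix n n 𝕜 => (cxLapF K c m2 (expLink K A U₀) (expLinkInv K A U₀))⁻¹)
      = (fun UV : CxLinks K 𝕜 n => (cxLapF K c m2 UV.1 UV.2)⁻¹) ∘ (fun A => ((expLink K A U₀, expLinkInv K A U₀) : CxLinks K 𝕜 n)) := rfl
  rw [hcomp]
  exact (analyticAt_cxLapF_inv K (UV₀ := ((expLink K A₀ U₀, expLinkInv K A₀ U₀) : CxLinks K 𝕜 n)) hU).comp_of_eq (analyticAt_expChart K U₀ A₀) rfl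

/-- The value at `A = 0`, unitary `U₀`: `G(e^{0}U₀) = (−cΔ_{U₀}+m²)⁻¹`. [cite: Balaban1985BackgroundPropagators, Thm 3.4 p.400] -/
theorem cxLapF_expChart_inv_zero (c m2 : ℝ) {U₀ : Tor K × Fin (d + 1) → Matrix n n 𝕜} (hU₀ : ∀ b, U₀ b ∈ Matrix.unitaryGroup n 𝕜) :
    (cxLapF K c m2 (expLink K (0 : Tor K × Fin (d + 1) → Matrix n n 𝕜) U₀) (expLinkInv K 0 U₀))⁻¹ = (covLapF K c m2 U₀)⁻¹ := by
  rw [cxLapF_expChart_zero K c m2 hU₀]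

/-- ★★★ **THM 3.4 IN THE MODEL — «EXTEND TO CONFIGURATIONS U′U … AS ANALYTIC FUNCTIONS OF A»**: for `c ≥ 0`, `m² > 0` and EVERY unitary `U₀`, the map `A ↦ G(e^{A}U₀)` is analytic at
`A = 0` (where it equals PART Ͱ's `(−cΔ_{U₀}+m²)⁻¹`). [cite: Balaban1985BackgroundPropagators, Thm 3.4 p.400, p.400 l.1–4] -/
theorem analyticAt_cxLapF_inv_expChart_zero {c m2 : ℝ} (hc : 0 ≤ c) (hm : 0 < m2) {U₀ : Tor K × Fin (d + 1) → Matrix n n 𝕜}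
    (hU₀ : ∀ b, U₀ b ∈ Matrix.unitaryGroup n 𝕜) :
    AnalyticAt 𝕜 (fun A : Tor K × Fin (d + 1) → Matrix n n 𝕜 => (cxLapF K c m2 (expLink K A U₀) (expLinkInv K A U₀))⁻¹) 0 := by
  refine analyticAt_cxLapF_inv_expChart K ?_
  rw [cxLapF_expChart_zero K c m2 hU₀]
  exact isUnit_covLapF K hc hm hU₀

/-! ## §4 The quantitative neighbourhood `‖A(b)‖ ≤ α`, `2(d+1)c(e^α − 1) < m²` -/

omit hK in
/-- For unitary `U₀` and `‖A(b)‖ ≤ α`: `‖e^{A(b)}U₀(b)‖ ≤ e^α = 1 + (e^α − 1)`. [cite: Balaban1985BackgroundPropagators, (3.37) p.396, p.400 l.1–4] -/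
theorem norm_expLink_le {U₀ A : Tor K × Fin (d + 1) → Matrix n n 𝕜} (hU₀ : ∀ b, U₀ b ∈ Matrix.unitaryGroup n 𝕜) {α : ℝ} (hA : ∀ b, ‖A b‖ ≤ α)
    (b : Tor K × Fin (d + 1)) : ‖expLink K A U₀ b‖ ≤ 1 + (Real.exp α - 1) := by
  unfold expLink
  rw [CStarRing.norm_mul_mem_unitary _ (hU₀ b), add_sub_cancel]
  exact (l2_opNorm_exp_le (A b)).trans (Real.exp_le_exp.mpr (hA b))

omit hK in
/-- For unitary `U₀` and `‖A(b)‖ ≤ α`: `‖U₀(b)⁻¹e^{−A(b)}‖ ≤ e^α = 1 + (e^α − 1)`. [cite: Balaban1985BackgroundPropagators, (3.37) p.396, p.400 l.1–4] -/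
theorem norm_expLinkInv_le {U₀ A : Tor K × Fin (d + 1) → Matrix n n 𝕜} (hU₀ : ∀ b, U₀ b ∈ Matrix.unitaryGroup n 𝕜) {α : ℝ} (hA : ∀ b, ‖A b‖ ≤ α)
    (b : Tor K × Fin (d + 1)) : ‖expLinkInv K A U₀ b‖ ≤ 1 + (Real.exp α - 1) := by
  unfold expLinkInv
  have h1 : (U₀ b)⁻¹ ∈ Matrix.unitaryGroup n 𝕜 := by
    have h2 : (U₀ b)ᴴ * U₀ b = 1 := by simpa only [star_eq_conjTranspose] using Matrix.mem_unitaryGroup_iff'.mp (hU₀ b)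
    rw [Matrix.inv_eq_left_inv h2]
    simpa only [star_eq_conjTranspose] using Unitary.star_mem (hU₀ b)
  rw [CStarRing.norm_mem_unitary_mul _ h1, add_sub_cancel]
  exact (l2_opNorm_exp_le (-(A b))).trans (Real.exp_le_exp.mpr (by rw [norm_neg]; exact hA b))

/-- ★★ **THE CHART LANDS IN THE WINDOW**: unitary `U₀`, `‖A(b)‖ ≤ α` (`α ≥ 0`), `2(d+1)c(e^α − 1) < m²` ⟹ `M_{e^{A}U₀, U₀⁻¹e^{−A}}` is invertible (PART Ϛ-b with `ε = e^α − 1`).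
[cite: Balaban1985BackgroundPropagators, Thm 3.4 p.400, p.400 l.1–4] -/
theorem isUnit_cxLapF_expChart {c m2 α : ℝ} (hc : 0 ≤ c) (hm : 0 < m2) (hα : 0 ≤ α) (hwin : 2 * ((d : ℝ) + 1) * c * (Real.exp α - 1) < m2)
    {U₀ A : Tor K × Fin (d + 1) → Matrix n n 𝕜} (hU₀ : ∀ b, U₀ b ∈ Matrix.unitaryGroup n 𝕜) (hA : ∀ b, ‖A b‖ ≤ α) :
    IsUnit (cxLapF K c m2 (expLink K A U₀) (expLinkInv K A U₀)) :=
  have hε : 0 ≤ Real.exp α - 1 := by have := Real.add_one_le_exp α; linarith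
  isUnit_cxLapF K hc hm hε hwin (norm_expLink_le K hU₀ hA) (norm_expLinkInv_le K hU₀ hA)

/-- ★★ **DOMINATION ON THE CHART**: there, `‖(G(e^{A}U₀))_{xy}‖_{op} ≤ (lapF K (e^α·c) (m² − 2(d+1)c(e^α−1)))⁻¹(x,y)` — King's kernel at the parameters shifted by the chart radius.
[cite: Balaban1985BackgroundPropagators, Thm 3.4 p.400, (3.42) p.397; King1986, (4.4) p.670] -/
theorem l2_opNorm_blk_cxLapF_inv_expChart_le {c m2 α : ℝ} (hc : 0 ≤ c) (hm : 0 < m2) (hα : 0 ≤ α) (hwin : 2 * ((d : ℝ) + 1) * c * (Real.exp α - 1) < m2)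
    {U₀ A : Tor K × Fin (d + 1) → Matrix n n 𝕜} (hU₀ : ∀ b, U₀ b ∈ Matrix.unitaryGroup n 𝕜) (hA : ∀ b, ‖A b‖ ≤ α) (x y : Tor K) :
    ‖blk (cxLapF K c m2 (expLink K A U₀) (expLinkInv K A U₀))⁻¹ x y‖
      ≤ (lapF K (Real.exp α * c) (m2 - 2 * ((d : ℝ) + 1) * c * (Real.exp α - 1)))⁻¹ x y := by
  have hε : 0 ≤ Real.exp α - 1 := by have := Real.add_one_le_exp α; linarith
  have h := l2_opNorm_blk_cxLapF_inv_le K hc hm hε hwin (norm_expLink_le K hU₀ hA) (norm_expLinkInv_le K hU₀ hA) x y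
  rwa [add_sub_cancel] at h

/-- ★★ **THE MODEL VALUE OF PRINT's `a₁` FOR THIS CHART**: for `c > 0`, `2(d+1)c(e^α − 1) < m² ⟺ α < log(1 + m²∕(2(d+1)c))` — every `α` below `log(1 + m²∕(2(d+1)c))` is admissible
(sufficient; PART Ϛ-d shows the underlying polydisc radius `m²∕(2(d+1)c)` is sharp for the two-sided family). [cite: Balaban1985BackgroundPropagators, Thm 3.4 p.400 («a positive constant a₁»)] -/
theorem expChart_window_iff {c m2 α : ℝ} (hc : 0 < c) (hm : 0 < m2) :
    2 * ((d : ℝ) + 1) * c * (Real.exp α - 1) < m2 ↔ α < Real.log (1 + m2 / (2 * ((d : ℝ) + 1) * c)) := by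
  have hD : 0 < 2 * ((d : ℝ) + 1) * c := by positivity
  have hpos : 0 < 1 + m2 / (2 * ((d : ℝ) + 1) * c) := by positivity
  rw [Real.lt_log_iff_exp_lt hpos]
  constructor
  · intro h
    have h2 : Real.exp α - 1 < m2 / (2 * ((d : ℝ) + 1) * c) := by
      rw [lt_div_iff₀ hD]; linarith
    linarith
  · intro h
    have h2 : Real.exp α - 1 < m2 / (2 * ((d : ℝ) + 1) * c) := by linarith
    rw [lt_div_iff₀ hD] at h2; linarith

/-! ## §5 The real slice: skew-adjoint `A` -/

omit hK in
/-- For skew-adjoint `A(b)` (`A(b)ᴴ = −A(b)`: print's `iηA(b)`, `A(b) ∈ u(n)`) and unitary `U₀`, `e^{A(b)}U₀(b)` is unitary (`(e^{A})ᴴe^{A} = e^{−A}e^{A} = 1`).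
[cite: Balaban1985BackgroundPropagators, p.400 l.1–4] -/
theorem expLink_mem_unitaryGroup_of_skew {U₀ A : Tor K × Fin (d + 1) → Matrix n n 𝕜} (hU₀ : ∀ b, U₀ b ∈ Matrix.unitaryGroup n 𝕜)
    (hA : ∀ b, (A b)ᴴ = -(A b)) (b : Tor K × Fin (d + 1)) : expLink K A U₀ b ∈ Matrix.unitaryGroup n 𝕜 := by
  unfold expLink
  have hexp : NormedSpace.exp (A b) ∈ Matrix.unitaryGroup n 𝕜 := by
    refine Matrix.mem_unitaryGroup_iff'.mpr ?_
    rw [star_eq_conjTranspose, ← Matrix.exp_conjTranspose, hA, ← Matrix.exp_add_of_commute _ _ ((Commute.refl (A b)).neg_left), neg_add_cancel,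
      NormedSpace.exp_zero]
  exact Submonoid.mul_mem _ hexp (hU₀ b)

omit hK in
/-- … and the backward chart is its adjoint: `U₀(b)⁻¹e^{−A(b)} = (e^{A(b)}U₀(b))ᴴ`. [cite: Balaban1985BackgroundPropagators, p.400 l.1–4] -/
theorem expLinkInv_eq_conjTranspose_of_skew {U₀ A : Tor K × Fin (d + 1) → Matrix n n 𝕜} (hU₀ : ∀ b, U₀ b ∈ Matrix.unitaryGroup n 𝕜)
    (hA : ∀ b, (A b)ᴴ = -(A b)) (b : Tor K × Fin (d + 1)) : expLinkInv K A U₀ b = (expLink K A U₀ b)ᴴ := by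
  rw [expLinkInv_eq_inv]
  have h1 : (expLink K A U₀ b)ᴴ * expLink K A U₀ b = 1 := by
    simpa only [star_eq_conjTranspose] using Matrix.mem_unitaryGroup_iff'.mp (expLink_mem_unitaryGroup_of_skew K hU₀ hA b)
  exact Matrix.inv_eq_left_inv h1

/-- ★ **ON `u(n)`-VALUED `A` THE CHART STAYS ON THE UNITARY SLICE**: its value is PART Ͱ's Hermitian `−cΔ_{e^{A}U₀}+m²` at the unitary field `e^{A}U₀`.
[cite: Balaban1985BackgroundPropagators, p.400 l.1–4, (3.23) p.394] -/
theorem cxLapF_expChart_of_skew (c m2 : ℝ) {U₀ A : Tor K × Fin (d + 1) → Matrix n n 𝕜} (hU₀ : ∀ b, U₀ b ∈ Matrix.unitaryGroup n 𝕜)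
    (hA : ∀ b, (A b)ᴴ = -(A b)) : cxLapF K c m2 (expLink K A U₀) (expLinkInv K A U₀) = covLapF K c m2 (expLink K A U₀) := by
  have h : expLinkInv K A U₀ = fun b => (expLink K A U₀ b)ᴴ := funext fun b => expLinkInv_eq_conjTranspose_of_skew K hU₀ hA b
  rw [h, cxLapF_adjoint]

end Summit.QuantumFields.YangMills.BalabanUVNodes.N15KingModelRung.Covariant

end
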